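import Summits.AtomisticToContinuum.FouriersLaw.Theorems.PhononMeanFreePathCoherentDephasingKickDissipation
import Summits.AtomisticToContinuum.FouriersLaw.Theorems.OddSectorIrreversibilitySubBallisticWindowGibbsMoments
import Summits.AtomisticToContinuum.FouriersLaw.Theorems.OddSectorIrreversibilitySubBallisticWindowGibbsPoincare

/-!
# Line `Sketch` of crux `PhononMeanFreePath.CoherentDephasing` (stmt-AtomisticToContinuum-11810): the head bound

Registered stub `stub_headBound` of the lead's skeleton (coherent-field Beer–Lambert), proved with exactly the
registered signature and, in fact, in a stronger form: for the `(N+1)`-site pinned anharmonic chain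
`pinnedChain ω₂ lam β γ` (all parameters `> 0`) with both Langevin baths at `T > 0`, the time-integrated coherent
energy flux `cohFlux … N b = -∫₀^∞ m_{b+1}(t) F_b(t) dt` through ANY bond `b` (vocabulary
`Theorems/PhononMeanFreePathDefs`, section CoherentField: `m_x = momResp = ⟨p₀, K_t p_x⟩_{μ_T}`,
`F_b = bondForceResp = ⟨p₀, K_t V'(q_{b+1} - q_b)⟩_{μ_T}`, `V'(r) = r + β r³`) is bounded by a constant
`B(ω₂, lam, β, γ, T)` UNIFORMLY IN `N` AND `b` (`cohFlux_le_uniform`).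

**Proof.** Two `N`-uniform inputs of the tree are combined.

1. *The dissipation bound for kick responses* (file `…CoherentDephasingKickDissipation`, from the Bakry–Émery
   inequality of the equilibrium semigroup, `…IncoherentBoundedDissipation`): for continuous `g = O(e^{H/(4T)})`,
   `∫₀^∞ (kickResp g)² dt ≤ (T/(2γ)) ∫ g² dμ_T` for every `N`. Hence `∫₀^∞ m_x² ≤ T²/(2γ)` for every site and
   `∫₀^∞ F_b² ≤ (T/(2γ)) ∫ V'(q_{b+1} - q_b)² dμ_T`.
2. *`N`-uniform Gibbs moments* (`stub_gibbsMoments` fed with the proved Brascamp–Lieb Poincaré inequality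
   `stub_gibbsPoincare`, files `OddSectorIrreversibilitySubBallisticWindowGibbs{Moments,Poincare}`):
   `∫ q_i^{2m} dμ_T ≤ C_m` for all `N`, `i`; so `∫ V'(q_{b+1} - q_b)² dμ_T ≤ M` uniformly
   (`(r + βr³)² ≤ 4(a² + c²) + 64β²(a⁶ + c⁶)` for `r = a - c`).

Then `-m F ≤ (m² + F²)/2` pointwise gives `cohFlux b ≤ (T²/(2γ) + (T/(2γ)) M)/2` (and `cohFlux b = 0` by the
Bochner convention if `m F` were not integrable). No locality in `b` is needed.
-/

noncomputable section

open MeasureTheory ProbabilityTheory Filter Topology Set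
open scoped NNReal ENNReal

namespace Summit.AtomisticToContinuum.FouriersLaw.Theorems.CoherentDephasing.HeadBound

open Literature.MathematicalPhysics.KineticTheory.HeatConduction
open Literature.MathematicalPhysics.KineticTheory Literature.Probability.Process OscillatorChain
open Summit.AtomisticToContinuum.FouriersLaw.Theorems.PhononMeanFreePath
open Summit.AtomisticToContinuum.FouriersLaw.Theorems.SubdiffusiveBondHeat
open Summit.AtomisticToContinuum.FouriersLaw.Theorems.CoherentDephasing.KickDissipation

/-! ## 1. `N`-uniform static Gibbs bounds -/

section Static

variable {ω₂ lam β : ℝ} (hω : 0 < ω₂) (hl : 0 ≤ lam) (hβ : 0 ≤ β) (γ : ℝ) {T : ℝ} (hT : 0 < T)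
include hω hl hβ hT

/-- **`N`-uniform even moments of the positions under the Gibbs measure**: for every `m` there is `C` with
`∫ q_i^{2m} dμ_T ≤ C` for ALL `N` and all sites `i` (the tree's `stub_gibbsMoments`, whose Poincaré
hypothesis is the proved `stub_gibbsPoincare` — Brascamp–Lieb for the uniformly convex Hamiltonian — rewritten
from the unnormalised weight `e^{-H/T} dq dp` to the normalised Gibbs measure). [folklore] -/
theorem gibbs_position_moment_le (m : ℕ) :
    ∃ C : ℝ, ∀ (N : ℕ) (i : Fin N),
      ∫ x, (x.1 i) ^ (2 * m) ∂((pinnedChain ω₂ lam β γ).gibbsMeasure N T) ≤ C := by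
  obtain ⟨C, hC⟩ := SubBallisticWindow.GibbsMoments.stub_gibbsMoments ω₂ lam β γ hω hl hβ T hT
    (SubBallisticWindow.GibbsPoincare.stub_gibbsPoincare ω₂ lam β γ hω hl hβ T hT) m
  refine ⟨C, fun N i => ?_⟩
  have h := (hC N i).1
  rw [SubBallisticWindow.GibbsMoments.integral_gibbs γ N rfl] at h
  have h' : ∫ x, (x.1 i) ^ (2 * m) * (pinnedChain ω₂ lam β γ).gibbsDensity N T x ≤
      C * ∫ x, (pinnedChain ω₂ lam β γ).gibbsDensity N T x := h
  have hZ : 0 < ∫ x, (pinnedChain ω₂ lam β γ).gibbsDensity N T x :=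
    integral_exp_pos (pinnedChain_integrable_gibbsDensity hω hl hβ γ N hT)
  rw [(pinnedChain ω₂ lam β γ).integral_gibbsMeasure]
  calc (∫ x, (pinnedChain ω₂ lam β γ).gibbsDensity N T x)⁻¹ *
        ∫ x, (x.1 i) ^ (2 * m) * (pinnedChain ω₂ lam β γ).gibbsDensity N T x
      ≤ (∫ x, (pinnedChain ω₂ lam β γ).gibbsDensity N T x)⁻¹ *
          (C * ∫ x, (pinnedChain ω₂ lam β γ).gibbsDensity N T x) :=
        mul_le_mul_of_nonneg_left h' (inv_nonneg.2 hZ.le)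
    _ = C := by rw [mul_comm C, ← mul_assoc, inv_mul_cancel₀ hZ.ne', one_mul]

omit hT in
/-- `|q_i|^k ≤ A_k e^{ϑ H}` for `ϑ > 0` (`|q_i| ≤ (1 + ω₂⁻¹)(1 + H)` and `(1+H)^k ≤ k! ϑ^{-k} e^ϑ e^{ϑH}`).
[folklore] -/
theorem abs_position_pow_le_exp {ϑ : ℝ} (hϑ : 0 < ϑ) (k : ℕ) (N : ℕ) (x : PhaseSpace N) (i : Fin N) :
    |x.1 i| ^ k ≤ ((1 + ω₂⁻¹) ^ k * (k.factorial / ϑ ^ k * Real.exp ϑ)) *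
      Real.exp (ϑ * (pinnedChain ω₂ lam β γ).hamiltonian N x) := by
  have hH := pinnedChain_hamiltonian_nonneg hω.le hl hβ γ N x
  have hq := SubBallisticWindow.GibbsMoments.abs_position_le hω hl hβ γ N x i
  have hA : 0 ≤ 1 + ω₂⁻¹ := by positivity
  have h1 : |x.1 i| ^ k ≤ ((1 + ω₂⁻¹) * (1 + (pinnedChain ω₂ lam β γ).hamiltonian N x)) ^ k :=
    pow_le_pow_left₀ (abs_nonneg _) hq k
  have h2 := OddSectorWitness.one_add_pow_le_exp_mul hH hϑ k
  calc |x.1 i| ^ k ≤ ((1 + ω₂⁻¹) * (1 + (pinnedChain ω₂ lam β γ).hamiltonian N x)) ^ k := h1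
    _ = (1 + ω₂⁻¹) ^ k * (1 + (pinnedChain ω₂ lam β γ).hamiltonian N x) ^ k := mul_pow _ _ _
    _ ≤ (1 + ω₂⁻¹) ^ k * ((k.factorial / ϑ ^ k * Real.exp ϑ) *
          Real.exp (ϑ * (pinnedChain ω₂ lam β γ).hamiltonian N x)) :=
        mul_le_mul_of_nonneg_left h2 (pow_nonneg hA k)
    _ = ((1 + ω₂⁻¹) ^ k * (k.factorial / ϑ ^ k * Real.exp ϑ)) *
          Real.exp (ϑ * (pinnedChain ω₂ lam β γ).hamiltonian N x) := by ring

/-- Powers of the positions are integrable under the Gibbs measure (`T > 0`). [folklore] -/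
theorem integrable_position_pow (k : ℕ) (N : ℕ) (i : Fin N) :
    Integrable (fun x : PhaseSpace N => (x.1 i) ^ k) ((pinnedChain ω₂ lam β γ).gibbsMeasure N T) := by
  have hϑ0 : (0 : ℝ) < 1 / (2 * T) := by positivity
  have hϑ1 : 1 / (2 * T) < 1 / T := by
    rw [div_lt_div_iff₀ (by positivity) hT]; nlinarith
  exact integrable_of_abs_le_exp
    (pinnedChain_integrable_exp_mul_hamiltonian_gibbsMeasure hω hl hβ γ N hT hϑ1) (by fun_prop)
    fun x => (abs_pow (x.1 i) k).trans_le (abs_position_pow_le_exp hω hl hβ γ hϑ0 k N x i)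

omit hω hl hβ hT in
/-- The elementary inequality behind the bond-force moment bound: for `r = a - c`,
`(r + β r³)² ≤ 4 (a² + c²) + 64 β² (a⁶ + c⁶)`. [folklore] -/
theorem bondForce_sq_le (β a c : ℝ) :
    ((a - c) + β * (a - c) ^ 3) ^ 2 ≤ 4 * (a ^ 2 + c ^ 2) + 64 * β ^ 2 * (a ^ 6 + c ^ 6) := by
  have hr2 : (a - c) ^ 2 ≤ 2 * (a ^ 2 + c ^ 2) := by nlinarith [sq_nonneg (a + c)]
  have hr6 : (a - c) ^ 6 ≤ 32 * (a ^ 6 + c ^ 6) := by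
    have h1 : ((a - c) ^ 2) ^ 3 ≤ (2 * (a ^ 2 + c ^ 2)) ^ 3 := pow_le_pow_left₀ (sq_nonneg _) hr2 3
    have ha : 0 ≤ a ^ 2 := sq_nonneg a
    have hc : 0 ≤ c ^ 2 := sq_nonneg c
    have h2 : (a ^ 2 + c ^ 2) ^ 3 ≤ 4 * ((a ^ 2) ^ 3 + (c ^ 2) ^ 3) := by
      nlinarith [mul_nonneg (add_nonneg ha hc) (sq_nonneg (a ^ 2 - c ^ 2))]
    calc (a - c) ^ 6 = ((a - c) ^ 2) ^ 3 := by ring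
      _ ≤ (2 * (a ^ 2 + c ^ 2)) ^ 3 := h1
      _ = 8 * (a ^ 2 + c ^ 2) ^ 3 := by ring
      _ ≤ 8 * (4 * ((a ^ 2) ^ 3 + (c ^ 2) ^ 3)) := by linarith
      _ = 32 * (a ^ 6 + c ^ 6) := by ring
  have hsq : ((a - c) + β * (a - c) ^ 3) ^ 2 ≤ 2 * (a - c) ^ 2 + 2 * (β ^ 2 * (a - c) ^ 6) := by
    nlinarith [sq_nonneg ((a - c) - β * (a - c) ^ 3)]
  have h3 : β ^ 2 * (a - c) ^ 6 ≤ β ^ 2 * (32 * (a ^ 6 + c ^ 6)) := mul_le_mul_of_nonneg_left hr6 (sq_nonneg β)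
  linarith

/-- **`N`-uniform second moment of the anharmonic bond force under the Gibbs measure**: there is `M ≥ 0` with
`∫ V'(q_{b+1} - q_b)² dμ_T ≤ M` for every `N` and every bond `b` of the `(N+1)`-site chain
(`V'(r) = r + β r³`; `bondForce_sq_le` and the uniform moments `gibbs_position_moment_le`). [folklore] -/
theorem gibbs_bondForce_sq_le :
    ∃ M : ℝ, 0 ≤ M ∧ ∀ (N : ℕ) (b : Fin N),
      ∫ y, ((y.1 b.succ - y.1 b.castSucc) + β * (y.1 b.succ - y.1 b.castSucc) ^ 3) ^ 2
        ∂((pinnedChain ω₂ lam β γ).gibbsMeasure (N + 1) T) ≤ M := by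
  obtain ⟨C₁, hC₁⟩ := gibbs_position_moment_le hω hl hβ γ hT 1
  obtain ⟨C₃, hC₃⟩ := gibbs_position_moment_le hω hl hβ γ hT 3
  have hC2 : ∀ (N : ℕ) (i : Fin N), ∫ x, (x.1 i) ^ 2 ∂((pinnedChain ω₂ lam β γ).gibbsMeasure N T) ≤ C₁ :=
    fun N i => by simpa using hC₁ N i
  have hC6 : ∀ (N : ℕ) (i : Fin N), ∫ x, (x.1 i) ^ 6 ∂((pinnedChain ω₂ lam β γ).gibbsMeasure N T) ≤ C₃ :=
    fun N i => by simpa using hC₃ N i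
  have hC₁0 : 0 ≤ C₁ :=
    (integral_nonneg (μ := (pinnedChain ω₂ lam β γ).gibbsMeasure 1 T)
      fun x : PhaseSpace 1 => even_two.pow_nonneg (x.1 0)).trans (hC2 1 0)
  have hC₃0 : 0 ≤ C₃ :=
    (integral_nonneg (μ := (pinnedChain ω₂ lam β γ).gibbsMeasure 1 T)
      fun x : PhaseSpace 1 => (by decide : Even 6).pow_nonneg (x.1 0)).trans (hC6 1 0)
  refine ⟨4 * (C₁ + C₁) + 64 * β ^ 2 * (C₃ + C₃), by positivity, fun N b => ?_⟩
  have hI : ∀ (k : ℕ) (i : Fin (N + 1)), Integrable (fun x : PhaseSpace (N + 1) => (x.1 i) ^ k)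
      ((pinnedChain ω₂ lam β γ).gibbsMeasure (N + 1) T) :=
    fun k i => integrable_position_pow hω hl hβ γ hT k (N + 1) i
  have hint : Integrable (fun y : PhaseSpace (N + 1) =>
      4 * ((y.1 b.succ) ^ 2 + (y.1 b.castSucc) ^ 2) + 64 * β ^ 2 * ((y.1 b.succ) ^ 6 + (y.1 b.castSucc) ^ 6))
      ((pinnedChain ω₂ lam β γ).gibbsMeasure (N + 1) T) :=
    (((hI 2 b.succ).fun_add (hI 2 b.castSucc)).const_mul 4).fun_add
      (((hI 6 b.succ).fun_add (hI 6 b.castSucc)).const_mul (64 * β ^ 2))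
  calc ∫ y, ((y.1 b.succ - y.1 b.castSucc) + β * (y.1 b.succ - y.1 b.castSucc) ^ 3) ^ 2
        ∂((pinnedChain ω₂ lam β γ).gibbsMeasure (N + 1) T)
      ≤ ∫ y, (4 * ((y.1 b.succ) ^ 2 + (y.1 b.castSucc) ^ 2) +
          64 * β ^ 2 * ((y.1 b.succ) ^ 6 + (y.1 b.castSucc) ^ 6)) ∂((pinnedChain ω₂ lam β γ).gibbsMeasure (N + 1) T) :=
        integral_mono_of_nonneg (ae_of_all _ fun y => sq_nonneg _) hint
          (ae_of_all _ fun y => bondForce_sq_le β (y.1 b.succ) (y.1 b.castSucc))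
    _ = 4 * ((∫ y, (y.1 b.succ) ^ 2 ∂((pinnedChain ω₂ lam β γ).gibbsMeasure (N + 1) T)) +
            ∫ y, (y.1 b.castSucc) ^ 2 ∂((pinnedChain ω₂ lam β γ).gibbsMeasure (N + 1) T)) +
          64 * β ^ 2 * ((∫ y, (y.1 b.succ) ^ 6 ∂((pinnedChain ω₂ lam β γ).gibbsMeasure (N + 1) T)) +
            ∫ y, (y.1 b.castSucc) ^ 6 ∂((pinnedChain ω₂ lam β γ).gibbsMeasure (N + 1) T)) := by
        rw [integral_add (((hI 2 b.succ).fun_add (hI 2 b.castSucc)).const_mul 4)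
            (((hI 6 b.succ).fun_add (hI 6 b.castSucc)).const_mul (64 * β ^ 2)),
          integral_const_mul, integral_const_mul, integral_add (hI 2 b.succ) (hI 2 b.castSucc),
          integral_add (hI 6 b.succ) (hI 6 b.castSucc)]
    _ ≤ 4 * (C₁ + C₁) + 64 * β ^ 2 * (C₃ + C₃) := by
        gcongr
        · exact hC2 (N + 1) b.succ
        · exact hC2 (N + 1) b.castSucc
        · exact hC6 (N + 1) b.succ
        · exact hC6 (N + 1) b.castSucc

omit hω hl hβ hT in
/-- From one-coordinate bounds to the bond force: `|a|, |c| ≤ X`, `|a|³, |c|³ ≤ Y`, `β ≥ 0` give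
`|(a - c) + β (a - c)³| ≤ 2X + 8βY` (`|a - c|³ ≤ 4(|a|³ + |c|³)`). [folklore] -/
theorem abs_bondForce_le_of_bounds {β a c X Y : ℝ} (hβ : 0 ≤ β) (ha : |a| ≤ X) (hc : |c| ≤ X)
    (ha3 : |a| ^ 3 ≤ Y) (hc3 : |c| ^ 3 ≤ Y) :
    |(a - c) + β * (a - c) ^ 3| ≤ 2 * X + 8 * β * Y := by
  have hr : |a - c| ≤ |a| + |c| := abs_sub a c
  have hr3 : |a - c| ^ 3 ≤ 4 * (|a| ^ 3 + |c| ^ 3) := by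
    have h1 : |a - c| ^ 3 ≤ (|a| + |c|) ^ 3 := pow_le_pow_left₀ (abs_nonneg _) hr 3
    nlinarith [mul_nonneg (add_nonneg (abs_nonneg a) (abs_nonneg c)) (sq_nonneg (|a| - |c|)),
      mul_nonneg (abs_nonneg a) (abs_nonneg c)]
  calc |(a - c) + β * (a - c) ^ 3| ≤ |a - c| + |β * (a - c) ^ 3| := abs_add_le _ _
    _ = |a - c| + β * |a - c| ^ 3 := by rw [abs_mul, abs_of_nonneg hβ, abs_pow]
    _ ≤ (|a| + |c|) + β * (4 * (|a| ^ 3 + |c| ^ 3)) := by gcongr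
    _ ≤ (X + X) + β * (4 * (Y + Y)) := by gcongr
    _ = 2 * X + 8 * β * Y := by ring

omit hT in
/-- Growth bound for the anharmonic bond force: `|V'(q_i - q_j)| ≤ B e^{ϑH}` (`ϑ > 0`). [folklore] -/
theorem abs_bondForce_le_exp {ϑ : ℝ} (hϑ : 0 < ϑ) (N : ℕ) (i j : Fin N) :
    ∃ B : ℝ, ∀ y : PhaseSpace N, |(y.1 i - y.1 j) + β * (y.1 i - y.1 j) ^ 3| ≤
      B * Real.exp (ϑ * (pinnedChain ω₂ lam β γ).hamiltonian N y) := by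
  refine ⟨2 * ((1 + ω₂⁻¹) ^ 1 * ((1 : ℕ).factorial / ϑ ^ 1 * Real.exp ϑ)) +
    8 * β * ((1 + ω₂⁻¹) ^ 3 * ((3 : ℕ).factorial / ϑ ^ 3 * Real.exp ϑ)), fun y => ?_⟩
  have hi1 := abs_position_pow_le_exp hω hl hβ γ hϑ 1 N y i
  have hj1 := abs_position_pow_le_exp hω hl hβ γ hϑ 1 N y j
  simp only [pow_one] at hi1 hj1
  have h := abs_bondForce_le_of_bounds hβ hi1 hj1 (abs_position_pow_le_exp hω hl hβ γ hϑ 3 N y i)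
    (abs_position_pow_le_exp hω hl hβ γ hϑ 3 N y j)
  calc _ ≤ _ := h
    _ = _ := by ring

end Static

/-! ## 2. The head bound -/

section Head

variable {ω₂ lam β γ : ℝ} (hω : 0 < ω₂) (hl : 0 ≤ lam) (hβ : 0 < β) (hγ : 0 < γ) {T : ℝ} (hT : 0 < T)
include hω hl hβ hγ hT

/-- **`N`-uniform bound on the coherent flux through every bond.** With `M` the uniform Gibbs bound on
`∫ V'(q_{b+1} - q_b)² dμ_T` (`gibbs_bondForce_sq_le`):
`cohFlux … N b ≤ (T²/(2γ) + (T/(2γ)) M) / 2` for every `N` and every bond `b` (`-mF ≤ (m² + F²)/2`, the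
`N`-uniform dissipation bounds `integral_kickResp_sq_le` for `g = p_{b+1}` and `g = V'(q_{b+1} - q_b)`,
equipartition `∫ p² dμ_T = T`). [folklore] -/
theorem cohFlux_le_uniform :
    ∃ B : ℝ, ∀ (N : ℕ) (b : Fin N), cohFlux ω₂ lam β γ T N b ≤ B := by
  obtain ⟨M, hM0, hM⟩ := gibbs_bondForce_sq_le hω hl hβ.le γ hT
  refine ⟨(T ^ 2 / (2 * γ) + T / (2 * γ) * M) / 2, fun N b => ?_⟩
  have hB0 : 0 ≤ (T ^ 2 / (2 * γ) + T / (2 * γ) * M) / 2 := by positivity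
  have hϑ0 : (0 : ℝ) < 1 / (4 * T) := by positivity
  -- growth bounds of the two observables
  have hgmB : ∀ y : PhaseSpace (N + 1), |y.2 b.succ| ≤
      (1 / 2 + 1 / (1 / (4 * T))) * Real.exp (1 / (4 * T) * (pinnedChain ω₂ lam β γ).hamiltonian (N + 1) y) :=
    fun y => CoherentDephasing.abs_momentum_le_exp hω.le hl hβ.le hϑ0 y b.succ
  obtain ⟨BF, hgFB⟩ := abs_bondForce_le_exp hω hl hβ.le γ hϑ0 (N + 1) b.succ b.castSucc
  have hgmc : Continuous fun y : PhaseSpace (N + 1) => y.2 b.succ := by fun_prop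
  have hgFc : Continuous fun y : PhaseSpace (N + 1) =>
      (y.1 b.succ - y.1 b.castSucc) + β * (y.1 b.succ - y.1 b.castSucc) ^ 3 := by fun_prop
  -- the time integrals of the squares
  have hmI : IntegrableOn (fun t => momResp ω₂ lam β γ T N b.succ t ^ 2) (Ioi 0) :=
    kickResp_sq_integrableOn hω hl hβ hγ hT N hgmc hgmB
  have hFI : IntegrableOn (fun t => bondForceResp ω₂ lam β γ T N b t ^ 2) (Ioi 0) :=
    kickResp_sq_integrableOn hω hl hβ hγ hT N hgFc hgFB
  have hm2 : ∫ t in Ioi (0 : ℝ), momResp ω₂ lam β γ T N b.succ t ^ 2 ≤ T ^ 2 / (2 * γ) := by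
    have h := integral_kickResp_sq_le hω hl hβ hγ hT N hgmc hgmB
    rw [pinnedChain_integral_momentum_sq_gibbsMeasure hω hl hβ.le (N + 1) hT b.succ] at h
    calc ∫ t in Ioi (0 : ℝ), momResp ω₂ lam β γ T N b.succ t ^ 2 ≤ T / (2 * γ) * T := h
      _ = T ^ 2 / (2 * γ) := by ring
  have hF2 : ∫ t in Ioi (0 : ℝ), bondForceResp ω₂ lam β γ T N b t ^ 2 ≤ T / (2 * γ) * M := by
    have h := integral_kickResp_sq_le hω hl hβ hγ hT N hgFc hgFB
    exact h.trans (mul_le_mul_of_nonneg_left (hM N b) (by positivity))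
  -- `cohFlux b = -∫ m F ≤ ∫ (m² + F²)/2`
  show -(∫ t in Ioi (0 : ℝ), momResp ω₂ lam β γ T N b.succ t * bondForceResp ω₂ lam β γ T N b t) ≤ _
  by_cases hI : IntegrableOn (fun t => momResp ω₂ lam β γ T N b.succ t * bondForceResp ω₂ lam β γ T N b t) (Ioi 0)
  · rw [← integral_neg]
    have hsum : IntegrableOn (fun t => (momResp ω₂ lam β γ T N b.succ t ^ 2 +
        bondForceResp ω₂ lam β γ T N b t ^ 2) / 2) (Ioi 0) := (hmI.fun_add hFI).div_const 2
    calc ∫ t in Ioi (0 : ℝ), -(momResp ω₂ lam β γ T N b.succ t * bondForceResp ω₂ lam β γ T N b t)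
        ≤ ∫ t in Ioi (0 : ℝ), (momResp ω₂ lam β γ T N b.succ t ^ 2 + bondForceResp ω₂ lam β γ T N b t ^ 2) / 2 :=
          integral_mono hI.neg hsum fun t => by
            show -(momResp ω₂ lam β γ T N b.succ t * bondForceResp ω₂ lam β γ T N b t) ≤
              (momResp ω₂ lam β γ T N b.succ t ^ 2 + bondForceResp ω₂ lam β γ T N b t ^ 2) / 2
            nlinarith [sq_nonneg (momResp ω₂ lam β γ T N b.succ t + bondForceResp ω₂ lam β γ T N b t)]
      _ = ((∫ t in Ioi (0 : ℝ), momResp ω₂ lam β γ T N b.succ t ^ 2) +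
            ∫ t in Ioi (0 : ℝ), bondForceResp ω₂ lam β γ T N b t ^ 2) / 2 := by
          rw [integral_div, integral_add hmI hFI]
      _ ≤ (T ^ 2 / (2 * γ) + T / (2 * γ) * M) / 2 := by linarith
  · rw [integral_undef hI, neg_zero]
    exact hB0

end Head

/-- **stub_headBound** (registered stub of line `Sketch`, crux `PhononMeanFreePath.CoherentDephasing`): for every
admissible parameter point and every depth `L` there is `B` with `cohFlux … N b ≤ B` for all `N` and all bonds
`b < L` of the `(N+1)`-site chain. In fact `B` works for every bond (`cohFlux_le_uniform`): the dissipation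
inequality of the equilibrium semigroup bounds `∫₀^∞ m_{b+1}²` and `∫₀^∞ F_b²` uniformly in `N` through
`N`-uniform Gibbs moments (Brascamp–Lieb), and `-m F ≤ (m² + F²)/2`. [folklore] -/
theorem stub_headBound : ∀ ω₂ lam β γ : ℝ, 0 < ω₂ → 0 < lam → 0 < β → 0 < γ → ∀ T : ℝ, 0 < T → ∀ L : ℕ,
    ∃ B : ℝ, ∀ (N : ℕ) (b : Fin N), (b : ℕ) < L → cohFlux ω₂ lam β γ T N b ≤ B := by
  intro ω₂ lam β γ hω hl hβ hγ T hT _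
  obtain ⟨B, hB⟩ := cohFlux_le_uniform hω hl.le hβ hγ hT
  exact ⟨B, fun N b _ => hB N b⟩

end Summit.AtomisticToContinuum.FouriersLaw.Theorems.CoherentDephasing.HeadBound

end
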